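import Summits.ValiantsHypothesis.ValiantsHypothesis.Theorems.DivisionGapPerDivisionHardStubGenericCut

/-!
# Crux `DivisionGap.PerDivisionHard` (stmt-ValiantsHypothesis-5065), line `pair-descent-jss-endpoint` —
stub `stub_orderedCut`: the generic cut with a prescribed priority list (ISOLATION rung)

`stub_orderedCut`: on any placed block `G = placedBlock eR eC` (`k ≥ 1`), for any `h ∈ ℝ≥0[x_ij]`
all of whose monomials have the same degree and any injective list `e : Fin t → cells` of cells
OFF the face, there is a weight `w` cutting out the face `G` whose top fibre `topComponent w h`
AGREES OFF `G` and is LEXICOGRAPHICALLY MINIMAL along `e` among all monomials of `h`.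

Proof.  Choose an injective ranking `ρ : cells → ℕ` giving `e 0, e 1, …, e (t-1)` the top ranks,
in this order (`exists_ranking`: `ρ (e i) = n² + (t - 1 - i)`, every other cell keeps its rank
`finProdFinEquiv f < n²`), and take the ordered generic weight `w = W` on `G`, `w f = W - B^{ρ f}`
off `G` (`B = deg h + 1`, `W = B^{n² + t}`).
1. `w` cuts out `G` (`cutsOut_of_forall`, verbatim `cutsOut_genericWeight`): every permutation
   weighs `≤ n · W` with equality iff all its cells lie in `G`, and some permutation lies in `G`
   (`exists_blockMatching` + `exists_perm_mem_placedBlock`).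
2. The weight of a monomial `m` is `W · deg m - S m` with the off-face digit sum
   `S m = Σ_{f ∉ G} m f · B^{ρ f}` (`weight_add_offSum`), so on the support of `h` (one degree)
   the top fibre consists of the monomials MINIMISING `S` (`offSum_le_of_mem_support_topComponent`).
3. Base-`B` domination (`sum_mul_pow_lt_of_lex`): if two digit vectors with digits `< B` agree at
   the cells ranked above `f₀` and `d₂ f₀ < d₁ f₀`, then `S d₂ < S d₁` (the cells ranked below `f₀`
   contribute `≤ Σ_{r < ρ f₀} (B - 1) B^r = B^{ρ f₀} - 1`).  Hence two fibre monomials agree off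
   `G` (apply 3 at the top-ranked off-face cell where they differ), and a fibre monomial `m₁` is
   lexicographically `≤` every monomial `m₂` of `h` along `e` (if they agree on `e j`, `j < i`,
   i.e. on all cells ranked above `e i`, then `m₂ (e i) < m₁ (e i)` would give `S m₂ < S m₁`).
-/

noncomputable section

-- `Summit.ValiantsHypothesis.ValiantsHypothesis.…` is the tree's mandated single-conjunct layout
-- (Sub = Summit), so the duplicated namespace component is intended.
set_option linter.dupNamespace false

namespace Summit.ValiantsHypothesis.ValiantsHypothesis.Theorems.DivisionGapPerDivisionHard

open MvPolynomial Literature.Computability.AlgebraicComplexity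
open Summit.ValiantsHypothesis.ValiantsHypothesis.Theorems.ZeroOneTransfer.Negative
open scoped NNReal

/-! ### Base-`B` domination -/

/-- **Base-`B` domination.**  For an injective ranking `ρ` and digit vectors `d₁, d₂` on a cell set
`T` with `d₂ < B`: if `d₁` and `d₂` agree at the cells of `T` ranked above `f₀ ∈ T` and
`d₂ f₀ < d₁ f₀`, then `Σ_{f ∈ T} d₂ f · B^{ρ f} < Σ_{f ∈ T} d₁ f · B^{ρ f}`. [folklore] -/
theorem sum_mul_pow_lt_of_lex {α : Type*} (T : Finset α) {ρ : α → ℕ} (hρ : Function.Injective ρ)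
    {B : ℕ} {d₁ d₂ : α → ℕ} {f₀ : α} (hf₀ : f₀ ∈ T) (hB : ∀ f ∈ T, d₂ f < B)
    (h₀ : d₂ f₀ < d₁ f₀) (hhi : ∀ f ∈ T, ρ f₀ < ρ f → d₁ f = d₂ f) :
    ∑ f ∈ T, d₂ f * B ^ ρ f < ∑ f ∈ T, d₁ f * B ^ ρ f := by
  classical
  set lo := T.filter fun f => ρ f < ρ f₀
  set hi := T.filter fun f => ¬ρ f < ρ f₀
  have hsplit : ∀ d : α → ℕ, ∑ f ∈ T, d f * B ^ ρ f =
      (∑ f ∈ lo, d f * B ^ ρ f) + ∑ f ∈ hi, d f * B ^ ρ f := fun d =>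
    (Finset.sum_filter_add_sum_filter_not T _ _).symm
  have hB1 : 1 ≤ B := Nat.one_le_of_lt (hB f₀ hf₀)
  -- the cells ranked below `f₀` contribute `< B ^ ρ f₀`
  have hlo : ∑ f ∈ lo, d₂ f * B ^ ρ f < B ^ ρ f₀ :=
    calc ∑ f ∈ lo, d₂ f * B ^ ρ f ≤ ∑ f ∈ lo, (B - 1) * B ^ ρ f :=
          Finset.sum_le_sum fun f hf =>
            Nat.mul_le_mul_right _ (Nat.le_sub_one_of_lt (hB f (Finset.mem_filter.mp hf).1))
      _ = ∑ r ∈ lo.image ρ, (B - 1) * B ^ r :=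
          (Finset.sum_image (f := fun r => (B - 1) * B ^ r) fun x _ y _ h => hρ h).symm
      _ ≤ ∑ r ∈ Finset.range (ρ f₀), (B - 1) * B ^ r := by
          refine Finset.sum_le_sum_of_subset_of_nonneg (fun r hr => ?_) fun _ _ _ => Nat.zero_le _
          obtain ⟨f, hf, rfl⟩ := Finset.mem_image.mp hr
          exact Finset.mem_range.mpr (Finset.mem_filter.mp hf).2
      _ < B ^ ρ f₀ := by
          have := geom_sum_mul_add (B - 1) (ρ f₀)
          rw [Nat.sub_add_cancel hB1, Finset.sum_mul] at this
          rw [← this, Finset.sum_congr rfl fun r _ => mul_comm (B - 1) (B ^ r)]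
          exact Nat.lt_succ_self _
  -- the cells ranked `≥ f₀`: `f₀` itself and cells where `d₁ = d₂`
  have hhi' : ∑ f ∈ hi, d₂ f * B ^ ρ f + B ^ ρ f₀ ≤ ∑ f ∈ hi, d₁ f * B ^ ρ f := by
    have hf₀hi : f₀ ∈ hi := Finset.mem_filter.mpr ⟨hf₀, lt_irrefl _⟩
    have heq : ∑ f ∈ hi.erase f₀, d₂ f * B ^ ρ f = ∑ f ∈ hi.erase f₀, d₁ f * B ^ ρ f := by
      refine Finset.sum_congr rfl fun f hf => ?_
      obtain ⟨hne, hf⟩ := Finset.mem_erase.mp hf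
      obtain ⟨hfT, hlt⟩ := Finset.mem_filter.mp hf
      rw [hhi f hfT (lt_of_le_of_ne (not_lt.mp hlt) fun h => hne (hρ h).symm)]
    rw [← Finset.add_sum_erase hi _ hf₀hi, ← Finset.add_sum_erase hi _ hf₀hi, heq]
    have : (d₂ f₀ + 1) * B ^ ρ f₀ ≤ d₁ f₀ * B ^ ρ f₀ := Nat.mul_le_mul_right _ h₀
    rw [add_mul, one_mul] at this
    omega
  rw [hsplit d₂, hsplit d₁]
  omega

/-! ### The ranking -/

/-- **The ranking.**  For an injective list `e : Fin t → cells` there is an injective ranking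
`ρ : cells → ℕ` with `ρ (e i) = K + (t - 1 - i)` (so `e 0, e 1, …` get the top ranks, in this
order) and `ρ f < K` for every cell `f` not in the list. [folklore] -/
theorem exists_ranking {n t : ℕ} (e : Fin t → Fin n × Fin n) (he : Function.Injective e) :
    ∃ (ρ : Fin n × Fin n → ℕ) (K : ℕ), Function.Injective ρ ∧
      (∀ i, ρ (e i) = K + (t - 1 - i)) ∧ ∀ f, (¬∃ i, e i = f) → ρ f < K := by
  classical
  let ρ : Fin n × Fin n → ℕ := fun f =>
    if hf : ∃ i, e i = f then n * n + (t - 1 - Fin.val (Classical.choose hf))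
    else (finProdFinEquiv f : ℕ)
  have hρe : ∀ i, ρ (e i) = n * n + (t - 1 - i) := fun i => by
    have hi : ∃ j, e j = e i := ⟨i, rfl⟩
    simp only [ρ, dif_pos hi, he (Classical.choose_spec hi)]
  have hρf : ∀ f, (¬∃ i, e i = f) → ρ f = finProdFinEquiv f := fun f hf => by
    simp only [ρ, dif_neg hf]
  refine ⟨ρ, n * n, fun f g hfg => ?_, hρe, fun f hf => (hρf f hf) ▸ (finProdFinEquiv f).2⟩
  by_cases hf : ∃ i, e i = f <;> by_cases hg : ∃ j, e j = g
  · obtain ⟨i, rfl⟩ := hf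
    obtain ⟨j, rfl⟩ := hg
    rw [hρe, hρe] at hfg
    have hij : (i : ℕ) = j := by have := i.2; have := j.2; omega
    rw [Fin.ext hij]
  · obtain ⟨i, rfl⟩ := hf
    rw [hρe, hρf g hg] at hfg
    have := (finProdFinEquiv g).2
    omega
  · obtain ⟨j, rfl⟩ := hg
    rw [hρf f hf, hρe] at hfg
    have := (finProdFinEquiv f).2
    omega
  · rw [hρf f hf, hρf g hg] at hfg
    exact finProdFinEquiv.injective (Fin.ext hfg)

/-! ### The ordered generic weight -/

variable {n : ℕ}

/-- **A two-level weight cuts out `G`** (`CutsOut w G`): if `w = W` on `G`, `w < W` off `G` and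
some permutation lies inside `G`, then a permutation lies in `G` iff its weight is maximal (every
permutation weighs at most `n · W`, with equality iff all its cells are in `G`). [folklore] -/
theorem cutsOut_of_forall (G : Finset (Fin n × Fin n)) (w : Fin n × Fin n → ℕ) (W : ℕ)
    (hG : ∀ f ∈ G, w f = W) (hlt : ∀ f ∉ G, w f < W) (σ₀ : Equiv.Perm (Fin n))
    (hσ₀ : ∀ x, (σ₀ x, x) ∈ G) : CutsOut w G := by
  have hle : ∀ f, w f ≤ W := fun f => if hf : f ∈ G then (hG f hf).le else (hlt f hf).le
  have hsum : ∀ τ : Equiv.Perm (Fin n), ∑ x, w (τ x, x) ≤ n * W := fun τ =>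
    calc ∑ x, w (τ x, x) ≤ ∑ _x : Fin n, W := Finset.sum_le_sum fun x _ => hle _
      _ = n * W := by simp
  have hin : ∀ τ : Equiv.Perm (Fin n), (∀ x, (τ x, x) ∈ G) → ∑ x, w (τ x, x) = n * W :=
    fun τ hτ => by
    rw [Finset.sum_congr rfl fun x _ => hG _ (hτ x)]
    simp
  intro σ
  constructor
  · intro hσ τ
    rw [hin σ hσ]
    exact hsum τ
  · intro hmax
    by_contra hno
    push Not at hno
    obtain ⟨x₀, hx₀⟩ := hno
    have hlt' : ∑ x, w (σ x, x) < n * W :=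
      calc ∑ x, w (σ x, x) < ∑ _x : Fin n, W :=
            Finset.sum_lt_sum (fun x _ => hle _) ⟨x₀, Finset.mem_univ _, hlt _ hx₀⟩
        _ = n * W := by simp
    have := hmax σ₀
    rw [hin σ₀ hσ₀] at this
    omega

/-- Weight plus off-`G` digit sum is `W · deg`: for a weight `w = W` on `G` and `w f + p f = W`
off `G`, `weight w m + Σ_{f ∉ G} m f · p f = W · deg m`. [folklore] -/
theorem weight_add_offSum (G : Finset (Fin n × Fin n)) {w p : Fin n × Fin n → ℕ} {W : ℕ}
    (hwG : ∀ f ∈ G, w f = W) (hwc : ∀ f ∉ G, w f + p f = W) (m : (Fin n × Fin n) →₀ ℕ) :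
    Finsupp.weight w m + ∑ f ∈ Gᶜ, m f * p f = W * m.degree := by
  rw [Finsupp.weight_apply, Finsupp.sum_fintype m (fun i c => c • w i) (fun _ => zero_smul _ _),
    Finsupp.degree_eq_sum, Finset.mul_sum, ← Finset.sum_add_sum_compl G fun f => m f • w f,
    ← Finset.sum_add_sum_compl G fun f => W * m f, add_assoc, ← Finset.sum_add_distrib]
  congr 1
  · exact Finset.sum_congr rfl fun f hf => by rw [smul_eq_mul, hwG f hf, mul_comm]
  · exact Finset.sum_congr rfl fun f hf => by
      rw [smul_eq_mul, ← mul_add, hwc f (Finset.mem_compl.mp hf), mul_comm]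

/-- **The top fibre minimises the off-`G` digit sum.**  For a weight `w = W` on `G`,
`w f + p f = W` off `G`: a monomial `m₁` of `topComponent w h` has off-`G` digit sum
`Σ_{f ∉ G} m₁ f · p f` at most that of any monomial `m₂` of `h` of the same degree. [folklore] -/
theorem offSum_le_of_mem_support_topComponent (G : Finset (Fin n × Fin n))
    {w p : Fin n × Fin n → ℕ} {W : ℕ} (hwG : ∀ f ∈ G, w f = W) (hwc : ∀ f ∉ G, w f + p f = W)
    {h : MvPolynomial (Fin n × Fin n) ℝ≥0} {m₁ m₂ : (Fin n × Fin n) →₀ ℕ}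
    (hm₁ : m₁ ∈ (topComponent w h).support) (hm₂ : m₂ ∈ h.support)
    (hdeg : m₁.degree = m₂.degree) : ∑ f ∈ Gᶜ, m₁ f * p f ≤ ∑ f ∈ Gᶜ, m₂ f * p f := by
  have h₁ := weight_add_offSum G hwG hwc m₁
  have h₂ := weight_add_offSum G hwG hwc m₂
  have htop : Finsupp.weight w m₁ = weightedTotalDegree w h :=
    weight_eq_of_mem_support_topComponent w h hm₁
  have hle : Finsupp.weight w m₂ ≤ weightedTotalDegree w h := le_weightedTotalDegree w hm₂
  rw [hdeg] at h₁
  omega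

/-! ### The stub -/

/-- **`stub_orderedCut`** (`stub_genericCut` with a prescribed priority list).  On any placed
block `G = placedBlock eR eC` (`k ≥ 1`), for any `h` all of whose monomials have the same degree
and any injective list `e : Fin t → cells` of cells OFF the face, there is a weight cutting out `G`
whose top fibre agrees off `G` AND is lexicographically minimal along `e` among ALL monomials of
`h`: the ordered generic weight `W` on `G`, `W - B^{ρ f}` off `G` (`B = deg h + 1`,
`W = B^{n² + t}`) for an injective ranking `ρ` giving `e 0, e 1, …` the top ranks
(`exists_ranking`); it cuts out `G` (`cutsOut_of_forall`), its top fibre minimises the off-face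
digit sum `Σ_{f ∉ G} m f · B^{ρ f}` (`offSum_le_of_mem_support_topComponent`), and a monomial
lexicographically smaller (from the top rank down) than a fibre monomial would have a smaller
off-face digit sum (`sum_mul_pow_lt_of_lex`, base-`B` domination). [folklore] -/
theorem stub_orderedCut :
    ∀ (b k m n t : ℕ) (eR eC : BlockV b k m ≃ Fin n) (e : Fin t → Fin n × Fin n)
      (h : MvPolynomial (Fin n × Fin n) ℝ≥0),
      0 < k → Function.Injective e → (∀ i, e i ∉ placedBlock eR eC) →
      (∀ m₁ ∈ h.support, ∀ m₂ ∈ h.support, m₁.degree = m₂.degree) →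
      ∃ w : Fin n × Fin n → ℕ, CutsOut w (placedBlock eR eC) ∧
        (∀ m₁ ∈ (topComponent w h).support, ∀ m₂ ∈ (topComponent w h).support,
          ∀ f ∉ placedBlock eR eC, m₁ f = m₂ f) ∧
        ∀ m₁ ∈ (topComponent w h).support, ∀ m₂ ∈ h.support, ∀ i : Fin t,
          (∀ j : Fin t, j < i → m₁ (e j) = m₂ (e j)) → m₁ (e i) ≤ m₂ (e i) := by
  intro b k m n t eR eC e h hk he heG hdeg
  obtain ⟨ρ, K, hρ, hρe, hρK⟩ := exists_ranking e he
  set G := placedBlock eR eC with hG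
  set B := h.totalDegree + 1 with hB
  have hB0 : 0 < B := Nat.succ_pos _
  -- the place values are at most `W = B ^ (K + t)`
  have hpW : ∀ f, B ^ ρ f ≤ B ^ (K + t) := fun f => Nat.pow_le_pow_right hB0 (by
    by_cases hf : ∃ i, e i = f
    · obtain ⟨i, rfl⟩ := hf
      rw [hρe]
      omega
    · exact ((hρK f hf).trans_le (Nat.le_add_right K t)).le)
  -- the ordered generic weight: `W` on `G`, `W - B ^ ρ f` off `G`
  obtain ⟨w, hwG, hwc⟩ : ∃ w : Fin n × Fin n → ℕ,
      (∀ f ∈ G, w f = B ^ (K + t)) ∧ ∀ f ∉ G, w f + B ^ ρ f = B ^ (K + t) :=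
    ⟨fun f => if f ∈ G then B ^ (K + t) else B ^ (K + t) - B ^ ρ f, fun f hf => if_pos hf,
      fun f hf => by simp only [if_neg hf, Nat.sub_add_cancel (hpW f)]⟩
  -- a permutation inside the placed face, from the diagonal perfect matching of `G(b,k) ⊕ M₀`
  obtain ⟨g, hg⟩ := exists_blockMatching b k m hk
  obtain ⟨σ₀, hσ₀⟩ := exists_perm_mem_placedBlock eR eC g hg
  -- digits of monomials of `h` are `< B`
  have hlt : ∀ m' ∈ h.support, ∀ f, m' f < B := fun m' hm' f =>
    Nat.lt_succ_of_le ((Finsupp.le_degree f m').trans (le_totalDegree hm'))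
  -- the top fibre minimises the off-face digit sum over `h.support`
  have hmin : ∀ m₁ ∈ (topComponent w h).support, ∀ m₂ ∈ h.support,
      ∑ f ∈ Gᶜ, m₁ f * B ^ ρ f ≤ ∑ f ∈ Gᶜ, m₂ f * B ^ ρ f := fun m₁ hm₁ m₂ hm₂ =>
    offSum_le_of_mem_support_topComponent G hwG hwc hm₁ hm₂
      (hdeg m₁ (support_topComponent_subset _ h hm₁) m₂ hm₂)
  refine ⟨w, cutsOut_of_forall G w (B ^ (K + t)) hwG (fun f hf => ?_) σ₀ hσ₀, ?_, ?_⟩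
  · have := hwc f hf
    have : 0 < B ^ ρ f := Nat.pow_pos hB0
    omega
  · -- the top fibre agrees off `G`: look at the top-ranked off-face cell where `m₁ ≠ m₂`
    intro m₁ hm₁ m₂ hm₂ f hf
    by_contra hne
    obtain ⟨f₀, hf₀, hmax⟩ := Finset.exists_max_image (Gᶜ.filter fun f => m₁ f ≠ m₂ f) ρ
      ⟨f, Finset.mem_filter.mpr ⟨Finset.mem_compl.mpr hf, hne⟩⟩
    obtain ⟨hf₀G, hne₀⟩ := Finset.mem_filter.mp hf₀
    have hhi : ∀ f' ∈ Gᶜ, ρ f₀ < ρ f' → m₁ f' = m₂ f' := fun f' hf' hlt' => by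
      by_contra h'
      exact absurd (hmax f' (Finset.mem_filter.mpr ⟨hf', h'⟩)) (not_le.mpr hlt')
    have hs₁ := support_topComponent_subset _ h hm₁
    have hs₂ := support_topComponent_subset _ h hm₂
    rcases lt_or_gt_of_ne hne₀ with h₀ | h₀
    · exact absurd (hmin m₂ hm₂ m₁ hs₁) (not_le.mpr (sum_mul_pow_lt_of_lex Gᶜ hρ hf₀G
        (fun f' _ => hlt m₁ hs₁ f') h₀ fun f' hf' hlt' => (hhi f' hf' hlt').symm))
    · exact absurd (hmin m₁ hm₁ m₂ hs₂) (not_le.mpr (sum_mul_pow_lt_of_lex Gᶜ hρ hf₀G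
        (fun f' _ => hlt m₂ hs₂ f') h₀ hhi))
  · -- lex-minimality along `e`: the cells ranked above `e i` are exactly the `e j`, `j < i`
    intro m₁ hm₁ m₂ hm₂ i hagree
    by_contra hlt'
    have hhi : ∀ f ∈ Gᶜ, ρ (e i) < ρ f → m₁ f = m₂ f := fun f _ hf => by
      by_cases hfe : ∃ j, e j = f
      · obtain ⟨j, rfl⟩ := hfe
        refine hagree j (Fin.lt_def.mpr ?_)
        rw [hρe, hρe] at hf
        have := j.2
        omega
      · have := hρK f hfe
        rw [hρe] at hf
        omega
    exact absurd (hmin m₁ hm₁ m₂ hm₂) (not_le.mpr (sum_mul_pow_lt_of_lex Gᶜ hρ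
      (Finset.mem_compl.mpr (heG i)) (fun f _ => hlt m₂ hm₂ f) (not_le.mp hlt') hhi))

end Summit.ValiantsHypothesis.ValiantsHypothesis.Theorems.DivisionGapPerDivisionHard

end
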